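import Summits.QuantumFields.YangMills.Theorems.VirialFluxGapCombConstantRadialFlow
import HarnessLib

/-!
# Route `VirialFluxGap` (YangMills): (E1) ON THE CENTRAL FAMILY — the zero-mode field gains `X_z·F₀ ≥ 2(1−ε)·F₀` on the comb-constant
# histories of the central chart (tree-gauged host `X_fix`), β-free

Brick (C1) of the central charts for ⟨stmt-QuantumFields-24141⟩.  On the 12-dimensional comb-constant family through a CENTRAL flat history
(`h_k = σ_k·1`, `q = σ₄·1`, signs `σ ∈ {±1}⁴`) the zero-mode block field with signs `σ` is the radial flow with generators `½σ_k·Im A_k`,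
`½σ₄·Im B`, and ✓`frameD_ringPoly_combConst_radial` computed `X_z·F₀` there EXACTLY: every commutator-quartic term of
✓`CombConstant.ringDeficit_combConst_eq_commutator_quartic` is reproduced with the factor `σ_k Re A_k + σ_{k′} Re A_{k′}`.  In the hemisphere
of the chart (`σ_B·Re q_B ≥ 1 − ε` for every block, which holds as soon as `|Im q_B|² ≤ ε` on the right hemisphere, `sign_mul_re_ge`) this gives
the drive inequality (E1) of the inline «EulerField» hypothesis ON THE FAMILY, with NO error term:

  ★★★ `cone_euler_ge` : `2(1 − ε)·F₀(combConst h q) ≤ frameD Y_σ ringPoly (ringCoord (combConst h q))`.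

* §1 the generators are skew-Hermitian and traceless (`quatMatrix_smul_im_conjTranspose` ∕ `_trace`, `wrapRadial_conjTranspose` ∕ `_trace`) —
  discharging the side conditions of ✓`CombConstantRadialFlow`;
* §2 `sign_mul_re_ge` — `σ·Re A ≥ 1 − ε` for a unit quaternion in the hemisphere `σ·Re A ≥ 0` with `|Im A|² ≤ ε`;
* §3 ★★★ `cone_euler_ge` and its hemisphere form `cone_euler_ge_of_im`.

HONEST FRAMING: (E1) on the central FAMILY only (the transverse Taylor transfer, (E2) off the family and the patching are NOT here); ⟨24141⟩
stays OPEN; the Yang–Mills mass gap is NOT proved; no summit is proved by a line.  THEOREMS ONLY (0 `def`, 0 `sorry`), standard axioms.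
Width seat `ym-line-sfw-p2-w3` g58 (cell ym-idea-1, free hands), `--supports stmt-QuantumFields-24141`.
References: [cite: CosteEtAl1985]; [cite: Luscher1983, §2].
-/

set_option autoImplicit false

noncomputable section

open scoped Matrix Quaternion BigOperators
open Literature.MathematicalPhysics.QuantumFieldTheory hiding SU2
open Literature.MathematicalPhysics.QuantumLattice

namespace Summit.QuantumFields.YangMills.Theorems.VirialFluxGap.FrameDerivative

open Summit.QuantumFields.YangMills.Theorems.FemtoTransferGap
open Summit.QuantumFields.YangMills.Theorems.FemtoTransferGap.TwoLattice.Flat (combFlat)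
open Summit.QuantumFields.YangMills.Theorems.VirialFluxGap.RingDeficit
open Summit.QuantumFields.YangMills.Theorems.VirialFluxGap.FrameHessian
open Summit.QuantumFields.YangMills.Theorems.VirialFluxGap.CombConstant

variable {L : ℕ} [NeZero L]

/-! ## §1 The radial generators are in `𝔰𝔲(2)` -/

omit [NeZero L] in
/-- A real multiple of an imaginary part is purely imaginary: `quatMatrix (c•Im q)` is skew-Hermitian. [folklore] -/
theorem quatMatrix_smul_im_conjTranspose (c : ℝ) (q : ℍ) : (quatMatrix (c • q.im))ᴴ = -quatMatrix (c • q.im) := by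
  have h : c • q.im = (⟨0, c * q.imI, c * q.imJ, c * q.imK⟩ : ℍ) := by ext <;> simp
  rw [h]
  exact quatMatrix_im_conjTranspose _ _ _

omit [NeZero L] in
/-- `quatMatrix (c•Im q)` is traceless. [folklore] -/
theorem quatMatrix_smul_im_trace (c : ℝ) (q : ℍ) : (quatMatrix (c • q.im)).trace = 0 := by
  have h : c • q.im = (⟨0, c * q.imI, c * q.imJ, c * q.imK⟩ : ℍ) := by ext <;> simp
  rw [h]
  exact quatMatrix_im_trace _ _ _

omit [NeZero L] in
/-- The wrap-layer radial assignment is skew-Hermitian everywhere. [folklore] -/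
theorem wrapRadial_conjTranspose (h : Fin 3 → SU2) (q : SU2) (c : Fin 3 → ℝ) (c₄ : ℝ)
    (w : (Fin (2 * L - 1 + 1) × Edge 3 L) ⊕ Site 3 L) :
    (Sum.elim (fun ie : Fin (2 * L - 1 + 1) × Edge 3 L =>
        if ie.2.1 ie.2.2 = -1 then quatMatrix (c ie.2.2 • (su2Quat (h ie.2.2)).im) else 0)
        (fun _ => quatMatrix (c₄ • (su2Quat q).im)) w)ᴴ =
      -Sum.elim (fun ie : Fin (2 * L - 1 + 1) × Edge 3 L =>
        if ie.2.1 ie.2.2 = -1 then quatMatrix (c ie.2.2 • (su2Quat (h ie.2.2)).im) else 0)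
        (fun _ => quatMatrix (c₄ • (su2Quat q).im)) w := by
  rcases w with ie | x
  · simp only [Sum.elim_inl]
    split_ifs
    · exact quatMatrix_smul_im_conjTranspose _ _
    · rw [Matrix.conjTranspose_zero, neg_zero]
  · simp only [Sum.elim_inr]
    exact quatMatrix_smul_im_conjTranspose _ _

omit [NeZero L] in
/-- The wrap-layer radial assignment is traceless everywhere. [folklore] -/
theorem wrapRadial_trace (h : Fin 3 → SU2) (q : SU2) (c : Fin 3 → ℝ) (c₄ : ℝ)
    (w : (Fin (2 * L - 1 + 1) × Edge 3 L) ⊕ Site 3 L) :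
    (Sum.elim (fun ie : Fin (2 * L - 1 + 1) × Edge 3 L =>
        if ie.2.1 ie.2.2 = -1 then quatMatrix (c ie.2.2 • (su2Quat (h ie.2.2)).im) else 0)
        (fun _ => quatMatrix (c₄ • (su2Quat q).im)) w).trace = 0 := by
  rcases w with ie | x
  · simp only [Sum.elim_inl]
    split_ifs
    · exact quatMatrix_smul_im_trace _ _
    · rw [Matrix.trace_zero]
  · simp only [Sum.elim_inr]
    exact quatMatrix_smul_im_trace _ _

/-! ## §2 The hemisphere bound on the radial factor -/

omit [NeZero L] in
/-- ★ **Hemisphere bound**: for a unit quaternion `A = su2Quat U` on the hemisphere of the sign `σ ∈ {±1}` (`σ·Re A ≥ 0`) with small imaginary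
part `|Im A|² ≤ ε`, the radial factor satisfies `σ·Re A ≥ 1 − ε` (`Re A² = 1 − |Im A|²`, `0 ≤ σRe A ≤ 1`). [folklore] -/
theorem sign_mul_re_ge {σ ε : ℝ} (hσ : σ = 1 ∨ σ = -1) (U : SU2) (hhem : 0 ≤ σ * (su2Quat U).re)
    (him : (su2Quat U).imI ^ 2 + (su2Quat U).imJ ^ 2 + (su2Quat U).imK ^ 2 ≤ ε) : 1 - ε ≤ σ * (su2Quat U).re := by
  have h1 : Quaternion.normSq (su2Quat U) = 1 := normSq_su2Quat U
  rw [Quaternion.normSq_def'] at h1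
  have e : (su2Quat U).re ^ 2 = 1 - ((su2Quat U).imI ^ 2 + (su2Quat U).imJ ^ 2 + (su2Quat U).imK ^ 2) := by
    have := h1; simp only [sq] at this ⊢; linarith
  have him0 : 0 ≤ (su2Quat U).imI ^ 2 + (su2Quat U).imJ ^ 2 + (su2Quat U).imK ^ 2 := by positivity
  have hσ2 : σ ^ 2 = 1 := by rcases hσ with h | h <;> simp [h]
  -- `t := σ·Re A` satisfies `0 ≤ t`, `t² = Re A² ≤ 1`, `t² ≥ 1 − ε`, hence `t ≥ t² ≥ 1 − ε`
  have ht2 : (σ * (su2Quat U).re) ^ 2 = (su2Quat U).re ^ 2 := by rw [mul_pow, hσ2, one_mul]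
  have hle1 : σ * (su2Quat U).re ≤ 1 := by nlinarith
  have hge : 1 - ε ≤ (σ * (su2Quat U).re) ^ 2 := by rw [ht2, e]; linarith
  nlinarith [mul_nonneg hhem (sub_nonneg.2 hle1)]

/-! ## §3 (E1) on the central family -/

/-- ★★★ **(E1) on the central comb-constant family, β-free and without error term.**  If every block of the comb-constant history
`(combFlat h, q)` has radial factor `σ_B·Re q_B ≥ 1 − ε`, the zero-mode field with signs `σ` (generators `½σ_k·Im A_k` on the wrap layers,
`½σ₄·Im B` on the seam) satisfies `2(1 − ε)·F₀ ≤ X_z·F₀` there. [cite: CosteEtAl1985] -/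
theorem cone_euler_ge (h : Fin 3 → SU2) (q : SU2) (σ : Fin 3 → ℝ) (σ₄ ε : ℝ)
    (hre : ∀ k, 1 - ε ≤ σ k * (su2Quat (h k)).re) (hre₄ : 1 - ε ≤ σ₄ * (su2Quat q).re) :
    2 * (1 - ε) * ringDeficit L (fun _ => false)
        ((fun _ : Fin (2 * L - 1 + 1) => combFlat (L := L) h, fun _ : Site 3 L => q) :
          (Fin (2 * L - 1 + 1) → GaugeConfig 3 L SU2) × (Site 3 L → SU2)) ≤
      frameD (Sum.elim (fun ie : Fin (2 * L - 1 + 1) × Edge 3 L =>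
          if ie.2.1 ie.2.2 = -1 then quatMatrix (((1 / 2 : ℝ) * σ ie.2.2) • (su2Quat (h ie.2.2)).im) else 0)
          (fun _ => quatMatrix (((1 / 2 : ℝ) * σ₄) • (su2Quat q).im))) (ringPoly L)
        (ringCoord L (((fun _ : Fin (2 * L - 1 + 1) => combFlat (L := L) h, fun _ : Site 3 L => q) :
          (Fin (2 * L - 1 + 1) → GaugeConfig 3 L SU2) × (Site 3 L → SU2)))) := by
  rw [frameD_ringPoly_combConst_radial h q (fun k => (1 / 2 : ℝ) * σ k) ((1 / 2 : ℝ) * σ₄)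
      (fun k => quatMatrix_smul_im_conjTranspose _ _) (fun k => quatMatrix_smul_im_trace _ _)
      (quatMatrix_smul_im_conjTranspose _ _) (quatMatrix_smul_im_trace _ _)
      (wrapRadial_conjTranspose h q (fun k => (1 / 2 : ℝ) * σ k) ((1 / 2 : ℝ) * σ₄))
      (wrapRadial_trace h q (fun k => (1 / 2 : ℝ) * σ k) ((1 / 2 : ℝ) * σ₄)),
    ringDeficit_combConst_eq_commutator_quartic]
  simp only [← Quaternion.normSq_eq_norm_mul_self, sq]
  -- every quartic term is reproduced with a factor `σ Re + σ' Re' ≥ 2(1 − ε)`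
  set N : {pr : Fin 3 × Fin 3 // pr.1 < pr.2} → ℝ := fun pr =>
    Quaternion.normSq (su2Quat (h pr.1.1) * su2Quat (h pr.1.2) - su2Quat (h pr.1.2) * su2Quat (h pr.1.1)) with hN
  set M : Fin 3 → ℝ := fun k => Quaternion.normSq (su2Quat (h k) * su2Quat q - su2Quat q * su2Quat (h k)) with hM
  have hN0 : ∀ pr, 0 ≤ N pr := fun pr => Quaternion.normSq_nonneg
  have hM0 : ∀ k, 0 ≤ M k := fun k => Quaternion.normSq_nonneg
  have h1 : 2 * (1 - ε) * ∑ pr : {pr : Fin 3 × Fin 3 // pr.1 < pr.2}, N pr ≤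
      ∑ pr : {pr : Fin 3 × Fin 3 // pr.1 < pr.2},
        2 * ((1 / 2 : ℝ) * σ pr.1.1 * (su2Quat (h pr.1.1)).re + (1 / 2 : ℝ) * σ pr.1.2 * (su2Quat (h pr.1.2)).re) * N pr := by
    rw [Finset.mul_sum]
    refine Finset.sum_le_sum fun pr _ => ?_
    have ha := hre pr.1.1
    have hb := hre pr.1.2
    have hn := hN0 pr
    nlinarith
  have h2 : 2 * (1 - ε) * ∑ k : Fin 3, M k ≤
      ∑ k : Fin 3, 2 * ((1 / 2 : ℝ) * σ k * (su2Quat (h k)).re + (1 / 2 : ℝ) * σ₄ * (su2Quat q).re) * M k := by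
    rw [Finset.mul_sum]
    refine Finset.sum_le_sum fun k _ => ?_
    have ha := hre k
    have hn := hM0 k
    nlinarith
  have hL2 : (0 : ℝ) ≤ (L : ℝ) ^ 2 := by positivity
  have h1' := mul_le_mul_of_nonneg_left h1 (by positivity : (0 : ℝ) ≤ 2 * (L : ℝ) ^ 2)
  have h2' := mul_le_mul_of_nonneg_left h2 hL2
  simp only [hN, hM] at h1' h2'
  linarith

/-- ★★ **(E1) on the central family, hemisphere form**: signs `σ ∈ {±1}`, every block variable on the hemisphere of its sign with
`|Im|² ≤ ε` ⇒ `2(1 − ε)·F₀ ≤ X_z·F₀` on the comb-constant history. [cite: CosteEtAl1985] -/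
theorem cone_euler_ge_of_im (h : Fin 3 → SU2) (q : SU2) (σ : Fin 3 → ℝ) (σ₄ ε : ℝ)
    (hσ : ∀ k, σ k = 1 ∨ σ k = -1) (hσ₄ : σ₄ = 1 ∨ σ₄ = -1)
    (hhem : ∀ k, 0 ≤ σ k * (su2Quat (h k)).re) (hhem₄ : 0 ≤ σ₄ * (su2Quat q).re)
    (him : ∀ k, (su2Quat (h k)).imI ^ 2 + (su2Quat (h k)).imJ ^ 2 + (su2Quat (h k)).imK ^ 2 ≤ ε)
    (him₄ : (su2Quat q).imI ^ 2 + (su2Quat q).imJ ^ 2 + (su2Quat q).imK ^ 2 ≤ ε) :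
    2 * (1 - ε) * ringDeficit L (fun _ => false)
        ((fun _ : Fin (2 * L - 1 + 1) => combFlat (L := L) h, fun _ : Site 3 L => q) :
          (Fin (2 * L - 1 + 1) → GaugeConfig 3 L SU2) × (Site 3 L → SU2)) ≤
      frameD (Sum.elim (fun ie : Fin (2 * L - 1 + 1) × Edge 3 L =>
          if ie.2.1 ie.2.2 = -1 then quatMatrix (((1 / 2 : ℝ) * σ ie.2.2) • (su2Quat (h ie.2.2)).im) else 0)
          (fun _ => quatMatrix (((1 / 2 : ℝ) * σ₄) • (su2Quat q).im))) (ringPoly L)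
        (ringCoord L (((fun _ : Fin (2 * L - 1 + 1) => combFlat (L := L) h, fun _ : Site 3 L => q) :
          (Fin (2 * L - 1 + 1) → GaugeConfig 3 L SU2) × (Site 3 L → SU2)))) :=
  cone_euler_ge h q σ σ₄ ε (fun k => sign_mul_re_ge (hσ k) (h k) (hhem k) (him k)) (sign_mul_re_ge hσ₄ q hhem₄ him₄)

end Summit.QuantumFields.YangMills.Theorems.VirialFluxGap.FrameDerivative

end
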